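import Mathlib.Analysis.SpecialFunctions.Exp
import HarnessLib

/-!
# K2R `RealisedQuasiStaticCellLaw`, line `floquet-bloch`, stub `stub_lowSectorWeakNear`: absorbing the slaving junk into the
# slot factor of the co-moving road (helper; `--supports stmt-AnomalousDissipation-20446`)

Summits-side helper file (pure real arithmetic; no definitions, no named facts). In `isoSector_decay_ae` (p582517) the slot
factor is `Θ_j ≥ max(e^{−8π²κ(n/2)²τ_j}, e^{−2(1−ε)λτ_j} + J_j/G_min)`; `iso_slot_factor_le` absorbs the junk:
`e^{−2(1−ε)L} + J ≤ e^{−2(1−2ε)L}` as soon as `J ≤ 2εL·e^{−2L}` (`L = λτ_j ≥ 0`, `ε ≥ 0`), so that `Θ_j = e^{−2(1−2ε)λτ_j}`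
and `∏_jΘ_j = e^{−2(1−2ε)λP}` exactly (the co-moving analogue of `weak_slot_factor_le`, p587050).
-/

set_option linter.dupNamespace false

namespace Summit.AnomalousDissipation.AnomalousDissipation.Theorems.SolenoidalFractalHomogenisation.RealisedQuasiStaticCellLaw

/-- **Junk absorption in the co-moving slot factor**: `e^{−2(1−ε)L} + J ≤ e^{−2(1−2ε)L}` if `J ≤ 2εL e^{−2L}`. -/
theorem iso_slot_factor_le {L ε J : ℝ} (hL : 0 ≤ L) (hε : 0 ≤ ε) (hJ : J ≤ 2 * ε * L * Real.exp (-(2 * L))) :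
    Real.exp (-(2 * (1 - ε) * L)) + J ≤ Real.exp (-(2 * (1 - 2 * ε) * L)) := by
  have h1 : Real.exp (-(2 * (1 - 2 * ε) * L)) = Real.exp (-(2 * (1 - ε) * L)) * Real.exp (2 * ε * L) := by
    rw [← Real.exp_add]; ring_nf
  have h2 : 1 + 2 * ε * L ≤ Real.exp (2 * ε * L) := by
    have := Real.add_one_le_exp (2 * ε * L); linarith
  have h3 : Real.exp (-(2 * L)) ≤ Real.exp (-(2 * (1 - ε) * L)) := Real.exp_le_exp.2 (by nlinarith)
  have h4 : 0 ≤ 2 * ε * L := by positivity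
  have h5 : J ≤ 2 * ε * L * Real.exp (-(2 * (1 - ε) * L)) := le_trans hJ (mul_le_mul_of_nonneg_left h3 h4)
  rw [h1]
  have h6 := mul_le_mul_of_nonneg_left h2 (Real.exp_pos (-(2 * (1 - ε) * L))).le
  nlinarith [h5, h6]

/-- The same with the free-decay branch: if moreover `2(1−2ε)L ≤ F` then
`max(e^{−F}, e^{−2(1−ε)L} + J) ≤ e^{−2(1−2ε)L}`. -/
theorem iso_slot_factor_max_le {L ε J F : ℝ} (hL : 0 ≤ L) (hε : 0 ≤ ε) (hJ : J ≤ 2 * ε * L * Real.exp (-(2 * L)))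
    (hF : 2 * (1 - 2 * ε) * L ≤ F) :
    max (Real.exp (-F)) (Real.exp (-(2 * (1 - ε) * L)) + J) ≤ Real.exp (-(2 * (1 - 2 * ε) * L)) :=
  max_le (Real.exp_le_exp.2 (by linarith)) (iso_slot_factor_le hL hε hJ)

end Summit.AnomalousDissipation.AnomalousDissipation.Theorems.SolenoidalFractalHomogenisation.RealisedQuasiStaticCellLaw
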